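import Summits.CriticalPhenomena.PercolationContinuityZ3.Theorems.PercNearOneGluingNoHeavyLowerTailSahiTangentCubeCheck

/-!
# The tangent inequality `T₃ ≥ 0` on `{0,1}^m × Bool`, `m ≤ 2`, for EVERY product measure — kernel-checked (`decide`)
# (Sahi programme, cell prim-sahi, prover prim-sahi-p2 gen 32)

Support file (`--supports stmt-CriticalPhenomena-4575`).  No definitions, no named facts, no sorries; standard axioms.

For `m ≤ 2`, every `p : Fin m → [0,1]` and all increasing events `A₀ ⊆ A₁`, `B₀ ⊆ B₁`, `C₀ ⊆ C₁` of `Set (Fin m)` (the pairs of sections of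
three arbitrary increasing events of the cube `{0,1}^m × Bool` along the last coordinate), with `μ = prodBernoulli p`:

  `0 ≤ T₃ = 2μ(A₀B₀C₀) + Σ_cyc (μA₁ − μA₀)μ(B₁C₁) + Σ_cyc μA₀μB₁μC₁ − Σ_cyc μA₁μ(B₀C₀) − 2μA₁μB₁μC₁`,

i.e. (memo `FROM-prim-sahi-p2-gen32-TANGENT.md`, `…SahiTangentChain`) for the coin `ε` of any bias `q` independent of `μ`:
`E₃^{μ⊗B_q}(A,B,C) ≥ q·E₃^{μ}(A₁,B₁,C₁)`, `q ↦ E₃/q` non-increasing, `E₃ ≥ ∂_q E₃` — Conjecture T (the lattice form of the increasing-star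
programme's R23) on the cubes `{0,1}^m × Bool`, `m ≤ 2`, all product measures.  Proof: `checkCubeT m σ` of `…SahiTangentCubeCheck` returns
`true` for `(m,σ) = (0,6), (1,9), (2,12)` in the KERNEL (`m = 2`: 20 increasing section pairs, 1 540 sorted triples, 16 base-`2^12` digits each);
`tangent_cube_nonneg_of_checkCubeT` does the rest.  `m = 3` (168 pairs, 804 440 sorted triples) is evaluated by compiled code in
`…SahiTangentCubeThree`.  With `A₀ = A₁, B₀ = B₁, C₀ = C₁` the statement is Sahi's `C₃` on `{0,1}^m` (`SahiC3Cube.sahiC3_cube_le_three`).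
-/

namespace Summit.CriticalPhenomena.PercolationContinuityZ3.Theorems.SahiTangent

open MeasureTheory Literature.Probability.Percolation Literature.Probability.LatticeModels

/-- The tangent cube check passes in dimension `0` (kernel evaluation). [this work] -/
theorem checkCubeT_zero : checkCubeT 0 6 = true := by decide +kernel

/-- The tangent cube check passes in dimension `1`: `3` increasing bitmasks, `6` section pairs (kernel evaluation). [this work] -/
theorem checkCubeT_one : checkCubeT 1 9 = true := by decide +kernel

/-- The tangent cube check passes in dimension `2`: `6` increasing bitmasks, `20` section pairs, `1 540` sorted triples, base `2^12` (kernel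
evaluation). [this work] -/
theorem checkCubeT_two : checkCubeT 2 12 = true := by decide +kernel

/-- **The tangent inequality `T₃ ≥ 0` on `{0,1}²` (i.e. on `{0,1}² × Bool`) for every product measure.** [this work] -/
theorem tangent_cube_two (p : Fin 2 → unitInterval) {A₀ A₁ B₀ B₁ C₀ C₁ : Set (Set (Fin 2))}
    (hA₀ : IsUpperSet A₀) (hA₁ : IsUpperSet A₁) (hB₀ : IsUpperSet B₀) (hB₁ : IsUpperSet B₁) (hC₀ : IsUpperSet C₀) (hC₁ : IsUpperSet C₁)
    (hA : A₀ ⊆ A₁) (hB : B₀ ⊆ B₁) (hC : C₀ ⊆ C₁) :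
    0 ≤ 2 * (prodBernoulli p).real (A₀ ∩ B₀ ∩ C₀)
      + ((prodBernoulli p).real A₁ - (prodBernoulli p).real A₀) * (prodBernoulli p).real (B₁ ∩ C₁)
      + ((prodBernoulli p).real B₁ - (prodBernoulli p).real B₀) * (prodBernoulli p).real (A₁ ∩ C₁)
      + ((prodBernoulli p).real C₁ - (prodBernoulli p).real C₀) * (prodBernoulli p).real (A₁ ∩ B₁)
      + (prodBernoulli p).real A₀ * (prodBernoulli p).real B₁ * (prodBernoulli p).real C₁
      + (prodBernoulli p).real B₀ * (prodBernoulli p).real A₁ * (prodBernoulli p).real C₁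
      + (prodBernoulli p).real C₀ * (prodBernoulli p).real A₁ * (prodBernoulli p).real B₁
      - (prodBernoulli p).real A₁ * (prodBernoulli p).real (B₀ ∩ C₀) - (prodBernoulli p).real B₁ * (prodBernoulli p).real (A₀ ∩ C₀)
      - (prodBernoulli p).real C₁ * (prodBernoulli p).real (A₀ ∩ B₀)
      - 2 * (prodBernoulli p).real A₁ * (prodBernoulli p).real B₁ * (prodBernoulli p).real C₁ :=
  tangent_cube_nonneg_of_checkCubeT checkCubeT_two p hA₀ hA₁ hB₀ hB₁ hC₀ hC₁ hA hB hC

/-- **The tangent inequality `T₃ ≥ 0` on `{0,1}^m`, `m ≤ 2`, for every product measure.** [this work] -/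
theorem tangent_cube_le_two {m : ℕ} (hm : m ≤ 2) (p : Fin m → unitInterval) {A₀ A₁ B₀ B₁ C₀ C₁ : Set (Set (Fin m))}
    (hA₀ : IsUpperSet A₀) (hA₁ : IsUpperSet A₁) (hB₀ : IsUpperSet B₀) (hB₁ : IsUpperSet B₁) (hC₀ : IsUpperSet C₀) (hC₁ : IsUpperSet C₁)
    (hA : A₀ ⊆ A₁) (hB : B₀ ⊆ B₁) (hC : C₀ ⊆ C₁) :
    0 ≤ 2 * (prodBernoulli p).real (A₀ ∩ B₀ ∩ C₀)
      + ((prodBernoulli p).real A₁ - (prodBernoulli p).real A₀) * (prodBernoulli p).real (B₁ ∩ C₁)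
      + ((prodBernoulli p).real B₁ - (prodBernoulli p).real B₀) * (prodBernoulli p).real (A₁ ∩ C₁)
      + ((prodBernoulli p).real C₁ - (prodBernoulli p).real C₀) * (prodBernoulli p).real (A₁ ∩ B₁)
      + (prodBernoulli p).real A₀ * (prodBernoulli p).real B₁ * (prodBernoulli p).real C₁
      + (prodBernoulli p).real B₀ * (prodBernoulli p).real A₁ * (prodBernoulli p).real C₁
      + (prodBernoulli p).real C₀ * (prodBernoulli p).real A₁ * (prodBernoulli p).real B₁
      - (prodBernoulli p).real A₁ * (prodBernoulli p).real (B₀ ∩ C₀) - (prodBernoulli p).real B₁ * (prodBernoulli p).real (A₀ ∩ C₀)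
      - (prodBernoulli p).real C₁ * (prodBernoulli p).real (A₀ ∩ B₀)
      - 2 * (prodBernoulli p).real A₁ * (prodBernoulli p).real B₁ * (prodBernoulli p).real C₁ := by
  interval_cases m
  · exact tangent_cube_nonneg_of_checkCubeT checkCubeT_zero p hA₀ hA₁ hB₀ hB₁ hC₀ hC₁ hA hB hC
  · exact tangent_cube_nonneg_of_checkCubeT checkCubeT_one p hA₀ hA₁ hB₀ hB₁ hC₀ hC₁ hA hB hC
  · exact tangent_cube_two p hA₀ hA₁ hB₀ hB₁ hC₀ hC₁ hA hB hC

end Summit.CriticalPhenomena.PercolationContinuityZ3.Theorems.SahiTangent
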